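import Literature.NumberTheory.EllipticCurves.RealLatticePeriodDiscrProofs
import Literature.NumberTheory.EllipticCurves.ModularCurveRealPeriodProofs
import Mathlib.Data.ZMod.QuotientGroup
import HarnessLib

/-!
# The real locus of a real lattice: components of `E(ℝ)` and the circle `ℝ/ℤΩ₀`

Topic `NumberTheory/EllipticCurves`; a proofs-only file (theorems only: no definitions, no named
facts) in `namespace PeriodPair` (deliberate dot-notation extensions of Mathlib's `PeriodPair`, as
in the sibling files `RealLatticePeriod*.lean`, `Uniformization.lean`).

For a **real** lattice `Λ ⊂ ℂ` (`PeriodPair.IsReal`: stable under complex conjugation) with least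
positive real period `Ω₀` (`PeriodPair.minRealPeriod`), the *real locus*
`R = {z ∈ ℂ | conj z − z ∈ Λ}` is the preimage of the real points `E_Λ(ℝ)` under
`ℂ → ℂ/Λ ≅ E_Λ(ℂ)` (Silverman, *Advanced Topics*, V.2).  It contains `ℝ + Λ` (the identity
component `ℝ/ℤΩ₀` of `E(ℝ)`), and this file proves, in the elementary language of subgroups of
`ℂ` (the subgroups `R` and `ℝ` enter through their membership predicates `hR`, `hB`, so that no
definition is added; `exists_addSubgroup_realLocus`, `exists_addSubgroup_realLine`):

* `IsReal.two_mul_halfPeriodI_mem`: with `Ω₀'` the least positive real period of the real lattice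
  `iΛ`, the point `w = iΩ₀'/2` has `2w ∈ Λ`, `w ∉ Λ`, `conj w = −w`;
* `IsReal.mem_sup_or_sub_mem_sup`: `R = (ℝ + Λ) ∪ (w + ℝ + Λ)`;
* `IsReal.halfPeriodI_mem_sup_iff`: `w ∈ ℝ + Λ ↔ w + Ω₀/2 ∈ Λ` (rhombic lattice);
* `IsReal.discr_pos_of_halfPeriodI_add_notMem` (with the tree's converse
  `IsReal.half_add_I_mul_half_notMem_of_discr_pos`, `ModularCurveRealPeriodProofs.lean`): the
  lattice is rectangular (`w + Ω₀/2 ∉ Λ`) iff `g₂³ − 27g₃² > 0` (Lawden, *Elliptic Functions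
  and Applications*, §§6.11–6.16: three real roots of `4x³ − g₂x − g₃` versus one), re-using the
  analysis of `RealLatticePeriodDiscrProofs.lean` (`℘` on the line `w + ℝ`);
* **`IsReal.relIndex_realLine_sup_lattice`**: `[R : ℝ + Λ] = 2` if `g₂³ − 27g₃² > 0` and `= 1`
  otherwise — the number of connected components of `E(ℝ)` (Silverman, *ATAEC*, V.2;
  `WeierstrassCurve.numRealComponents` of `RealPeriod.lean`);
* **`IsReal.relIndex_lattice_mul_minRealPeriod_eq`**: for real `α ≠ 0` with `αΛ ⊆ Λ'` (`Λ'`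
  real with least positive real period `Ω₀'`), the subgroup `S = {t ∈ ℝ | αt ∈ Λ'} = ℤ·Ω₀'/α`
  contains `Λ ∩ ℝ = ℤΩ₀` with index `k₀`, `k₀ · Ω₀' = |α| · Ω₀` — the order of the kernel of
  `t ↦ αt : ℝ/ℤΩ₀ → ℝ/ℤΩ₀'`.

These are the lattice-side inputs of the archimedean local factor of an isogeny in Milne's proof
of the isogeny invariance of the Birch–Swinnerton-Dyer conjecture (*Arithmetic Duality Theorems*,
Thm. I.7.3; file `IsogenyRealPeriodProofs.lean`).

## References

* J. H. Silverman, *Advanced Topics in the Arithmetic of Elliptic Curves*, GTM 151, V.2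
  (`E(ℝ)`, its components, `E(ℝ) ≅ ℝ/ℤ` or `ℝ/ℤ × ℤ/2`).
* D. F. Lawden, *Elliptic Functions and Applications*, Springer 1989, §§6.11–6.17 (rectangular
  and rhombic real lattices).
* J. S. Milne, *Arithmetic Duality Theorems*, 2nd ed. (2006), Ch. I §7, proof of Thm. 7.3.
  [MilneADT2006]
-/

noncomputable section

open scoped ComplexConjugate

namespace PeriodPair

open Complex Set

variable {L : PeriodPair}

/-! ### The subgroups `R = {z | conj z − z ∈ Λ}` and `ℝ ⊂ ℂ`, by membership -/

/-- The real locus `{z ∈ ℂ | conj z − z ∈ Λ}` of a lattice is a subgroup of `ℂ`. [folklore] -/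
theorem exists_addSubgroup_realLocus (L : PeriodPair) :
    ∃ R : AddSubgroup ℂ, ∀ z, z ∈ R ↔ conj z - z ∈ L.lattice := by
  refine ⟨L.lattice.toAddSubgroup.comap
    ((Complex.conjAe.toRingHom : ℂ →+* ℂ).toAddMonoidHom - AddMonoidHom.id ℂ), fun z ↦ ?_⟩
  simp only [AddSubgroup.mem_comap, AddMonoidHom.sub_apply, RingHom.toAddMonoidHom_eq_coe,
    AddMonoidHom.coe_coe, AddMonoidHom.id_apply, Submodule.mem_toAddSubgroup]
  rfl

/-- The real line `ℝ ⊂ ℂ` is a subgroup of `ℂ`. [folklore] -/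
theorem exists_addSubgroup_realLine :
    ∃ B : AddSubgroup ℂ, ∀ z, z ∈ B ↔ (z.re : ℂ) = z := by
  refine ⟨(Complex.ofRealHom : ℝ →+* ℂ).toAddMonoidHom.range, fun z ↦ ?_⟩
  simp only [AddMonoidHom.mem_range, RingHom.toAddMonoidHom_eq_coe, AddMonoidHom.coe_coe,
    Complex.ofRealHom_eq_coe]
  constructor
  · rintro ⟨t, rfl⟩; simp
  · intro h; exact ⟨z.re, h⟩

section RealLocus

variable {R B : AddSubgroup ℂ} (hR : ∀ z, z ∈ R ↔ conj z - z ∈ L.lattice)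
  (hB : ∀ z, z ∈ B ↔ (z.re : ℂ) = z)

include hB in
/-- Real numbers belong to the real line. [folklore] -/
theorem ofReal_mem_realLine (t : ℝ) : (t : ℂ) ∈ B := (hB _).2 (by simp)

include hB in
/-- Members of the real line are real numbers. [folklore] -/
theorem exists_eq_ofReal_of_mem_realLine {z : ℂ} (hz : z ∈ B) : ∃ t : ℝ, z = t :=
  ⟨z.re, ((hB z).1 hz).symm⟩

include hR in
/-- `Λ ≤ R` for a real lattice. [folklore] -/
theorem lattice_le_realLocus (h : L.IsReal) : L.lattice.toAddSubgroup ≤ R := fun z hz ↦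
  (hR z).2 (sub_mem (h z hz) hz)

include hR hB in
/-- `ℝ ≤ R`. [folklore] -/
theorem realLine_le_realLocus : B ≤ R := fun z hz ↦ by
  obtain ⟨t, rfl⟩ := exists_eq_ofReal_of_mem_realLine hB hz
  exact (hR _).2 (by simp)

include hR in
/-- Membership in the real locus in terms of the imaginary part: `z ∈ R ↔ 2 Im(z) i ∈ Λ`.
[folklore] -/
theorem mem_realLocus_iff_im (z : ℂ) : z ∈ R ↔ ((2 * z.im : ℝ) : ℂ) * I ∈ L.lattice := by
  rw [hR, show conj z - z = -(z - conj z) by ring, Complex.sub_conj]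
  exact ⟨fun h ↦ by simpa using neg_mem h, fun h ↦ neg_mem h⟩

include hR in
/-- For real `α` with `αΛ ⊆ Λ'`, multiplication by `α` maps the real locus of `Λ` into that of
`Λ'`. [folklore] -/
theorem mul_mem_realLocus {L' : PeriodPair} {R' : AddSubgroup ℂ}
    (hR' : ∀ z, z ∈ R' ↔ conj z - z ∈ L'.lattice) {α : ℝ}
    (hα : ∀ l ∈ L.lattice, (α : ℂ) * l ∈ L'.lattice) {z : ℂ} (hz : z ∈ R) :
    (α : ℂ) * z ∈ R' := by
  rw [hR'] ; rw [hR] at hz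
  have : conj ((α : ℂ) * z) - α * z = α * (conj z - z) := by
    rw [map_mul, Complex.conj_ofReal]; ring
  rw [this]
  exact hα _ hz

/-! ### The half-period `w = iΩ₀'/2` of a real lattice -/

/-- For a real lattice `Λ` with `Ω₀'` the least positive real period of the real lattice `iΛ`,
the point `w = iΩ₀'/2` satisfies `2w ∈ Λ`, `w ∉ Λ`, `conj w = -w`. [folklore] -/
theorem IsReal.two_mul_halfPeriodI_mem (h : L.IsReal) :
    2 * (I * (((L.mulLeft I I_ne_zero).minRealPeriod / 2 : ℝ) : ℂ)) ∈ L.lattice ∧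
      I * (((L.mulLeft I I_ne_zero).minRealPeriod / 2 : ℝ) : ℂ) ∉ L.lattice ∧
      conj (I * (((L.mulLeft I I_ne_zero).minRealPeriod / 2 : ℝ) : ℂ)) =
        -(I * (((L.mulLeft I I_ne_zero).minRealPeriod / 2 : ℝ) : ℂ)) := by
  set L' := L.mulLeft I I_ne_zero with hL'
  have h' : L'.IsReal := h.mulLeft_I
  have hΩ' := h'.minRealPeriod_pos
  set w : ℂ := I * ((L'.minRealPeriod / 2 : ℝ) : ℂ) with hw
  refine ⟨?_, ?_, ?_⟩
  · have h1 : (L'.minRealPeriod : ℂ) ∈ L'.lattice := h'.minRealPeriod_mem_lattice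
    rw [hL', mem_mulLeft_lattice, Complex.inv_I] at h1
    have := neg_mem h1
    convert this using 1
    rw [hw]; push_cast; ring
  · intro hwmem
    have h1 : I * w ∈ L'.lattice := mul_mem_mulLeft_lattice.mpr hwmem
    have h2 : ((L'.minRealPeriod / 2 : ℝ) : ℂ) ∈ L'.lattice := by
      have := neg_mem h1
      rw [hw, ← mul_assoc, Complex.I_mul_I] at this
      simpa using this
    have := h'.minRealPeriod_le ⟨by positivity, h2⟩
    linarith
  · rw [map_mul, Complex.conj_I, Complex.conj_ofReal]; ring

include hR hB in
/-- **The real locus is `(ℝ + Λ) ∪ (w + ℝ + Λ)`**: every `z` with `conj z − z ∈ Λ` has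
`2 Im(z) i ∈ Λ ∩ iℝ = ℤ · iΩ₀'`, so `z ≡ Re(z)` or `z ≡ Re(z) + w` modulo `Λ`, `w = iΩ₀'/2`.
[folklore] -/
theorem IsReal.mem_sup_or_sub_mem_sup (h : L.IsReal) {z : ℂ} (hz : z ∈ R) :
    z ∈ B ⊔ L.lattice.toAddSubgroup ∨
      z - I * (((L.mulLeft I I_ne_zero).minRealPeriod / 2 : ℝ) : ℂ) ∈
        B ⊔ L.lattice.toAddSubgroup := by
  set L' := L.mulLeft I I_ne_zero with hL'
  have h' : L'.IsReal := h.mulLeft_I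
  obtain ⟨h2w, -, -⟩ := h.two_mul_halfPeriodI_mem
  set w : ℂ := I * ((L'.minRealPeriod / 2 : ℝ) : ℂ) with hw
  -- `2 Im(z) ∈ Λ'` hence `2 Im z = k Ω₀'`
  have hs : ((2 * z.im : ℝ) : ℂ) ∈ L'.lattice := by
    rw [hL', mem_mulLeft_lattice, Complex.inv_I]
    have := (mem_realLocus_iff_im hR z).1 hz
    have := neg_mem this
    convert this using 1
    ring
  obtain ⟨k, hk⟩ := h'.exists_eq_int_mul hs
  have hzdecomp : z = (z.re : ℂ) + (k : ℂ) * w := by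
    have him : (z.im : ℂ) = (k : ℂ) * ((L'.minRealPeriod / 2 : ℝ) : ℂ) := by
      have : (z.im : ℝ) = k * (L'.minRealPeriod / 2) := by linarith
      rw [this]; push_cast; ring
    calc z = (z.re : ℂ) + (z.im : ℂ) * I := (Complex.re_add_im z).symm
      _ = (z.re : ℂ) + (k : ℂ) * w := by rw [him, hw]; ring
  have hre : (z.re : ℂ) ∈ B ⊔ L.lattice.toAddSubgroup :=
    AddSubgroup.mem_sup_left (ofReal_mem_realLine hB _)
  have h2wmem : ∀ j : ℤ, (j : ℂ) * (2 * w) ∈ B ⊔ L.lattice.toAddSubgroup := fun j ↦ by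
    apply AddSubgroup.mem_sup_right
    have := zsmul_mem h2w j
    rwa [zsmul_eq_mul] at this
  rcases Int.even_or_odd k with ⟨j, rfl⟩ | ⟨j, rfl⟩
  · left
    rw [hzdecomp]
    refine add_mem hre ?_
    convert h2wmem j using 1
    push_cast; ring
  · right
    rw [hzdecomp]
    have : (z.re : ℂ) + ((j + j + 1 : ℤ) : ℂ) * w - w = (z.re : ℂ) + (j : ℂ) * (2 * w) := by
      push_cast; ring
    rw [show ((2 * j + 1 : ℤ) : ℂ) = ((j + j + 1 : ℤ) : ℂ) by push_cast; ring, this]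
    exact add_mem hre (h2wmem j)

include hB in
/-- `w ∈ ℝ + Λ ↔ w + Ω₀/2 ∈ Λ` (rhombic lattice), for `w = iΩ₀'/2`. [folklore] -/
theorem IsReal.halfPeriodI_mem_sup_iff (h : L.IsReal) :
    I * (((L.mulLeft I I_ne_zero).minRealPeriod / 2 : ℝ) : ℂ) ∈ B ⊔ L.lattice.toAddSubgroup ↔
      I * (((L.mulLeft I I_ne_zero).minRealPeriod / 2 : ℝ) : ℂ) + ((L.minRealPeriod / 2 : ℝ) : ℂ) ∈
        L.lattice := by
  obtain ⟨-, hwn, hcw⟩ := h.two_mul_halfPeriodI_mem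
  set w : ℂ := I * (((L.mulLeft I I_ne_zero).minRealPeriod / 2 : ℝ) : ℂ) with hw
  constructor
  · intro hmem
    rw [AddSubgroup.mem_sup] at hmem
    obtain ⟨b, hb, l, hl, hbl⟩ := hmem
    rw [Submodule.mem_toAddSubgroup] at hl
    obtain ⟨t, rfl⟩ := exists_eq_ofReal_of_mem_realLine hB hb
    -- `l = w - t ∈ Λ`, `conj l = -w - t ∈ Λ`, so `2t ∈ Λ`
    have hl' : w - t ∈ L.lattice := by rw [← hbl]; simpa using hl
    have hcl : -w - t ∈ L.lattice := by
      have := h _ hl'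
      rwa [map_sub, hcw, Complex.conj_ofReal] at this
    have h2t : ((-(2 * t) : ℝ) : ℂ) ∈ L.lattice := by
      convert add_mem hl' hcl using 1
      push_cast; ring
    obtain ⟨k, hk⟩ := h.exists_eq_int_mul h2t
    have hzmul : ∀ j : ℤ, ((j : ℝ) : ℂ) * (L.minRealPeriod : ℂ) ∈ L.lattice := by
      intro j
      have := zsmul_mem h.minRealPeriod_mem_lattice j
      rw [zsmul_eq_mul] at this
      exact_mod_cast this
    rcases Int.even_or_odd k with ⟨j, rfl⟩ | ⟨j, rfl⟩
    · exfalso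
      have ht' : t = -j * L.minRealPeriod := by push_cast at hk; linarith
      have htmem : (t : ℂ) ∈ L.lattice := by
        rw [ht']; push_cast
        have := neg_mem (hzmul j)
        convert this using 1; push_cast; ring
      exact hwn (by simpa using add_mem hl' htmem)
    · have ht' : t = -j * L.minRealPeriod - L.minRealPeriod / 2 := by push_cast at hk; linarith
      have : w + ((L.minRealPeriod / 2 : ℝ) : ℂ) =
          (w - t) - ((j : ℝ) : ℂ) * (L.minRealPeriod : ℂ) := by
        rw [ht']; push_cast; ring
      rw [this]
      exact sub_mem hl' (hzmul j)
  · intro hmem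
    have : w = ((-(L.minRealPeriod / 2) : ℝ) : ℂ) + (w + ((L.minRealPeriod / 2 : ℝ) : ℂ)) := by
      push_cast; ring
    rw [this]
    exact AddSubgroup.mem_sup.2 ⟨_, ofReal_mem_realLine hB _, _,
      (Submodule.mem_toAddSubgroup _).2 hmem, rfl⟩

end RealLocus

end PeriodPair

namespace PeriodPair

open Complex Set

variable {L : PeriodPair}

/-! ### Rectangular versus rhombic: the sign of the discriminant -/

/-- A cubic `4x³ − Ax − B` with three distinct real roots has positive discriminant
`A³ − 27B² = 16·((a−b)(b−c)(a−c))² > 0`. [folklore] -/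
lemma cubic_discr_pos_of_roots {A B a b c : ℝ} (hab : a ≠ b) (hac : a ≠ c) (hbc : b ≠ c)
    (ha : 4 * a ^ 3 - A * a - B = 0) (hb : 4 * b ^ 3 - A * b - B = 0)
    (hc : 4 * c ^ 3 - A * c - B = 0) : 0 < A ^ 3 - 27 * B ^ 2 := by
  have h1 : 4 * (a ^ 2 + a * b + b ^ 2) - A = 0 := by
    have : (a - b) * (4 * (a ^ 2 + a * b + b ^ 2) - A) = 0 := by linear_combination ha - hb
    exact (mul_eq_zero.mp this).resolve_left (sub_ne_zero.mpr hab)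
  have h2 : 4 * (a ^ 2 + a * c + c ^ 2) - A = 0 := by
    have : (a - c) * (4 * (a ^ 2 + a * c + c ^ 2) - A) = 0 := by linear_combination ha - hc
    exact (mul_eq_zero.mp this).resolve_left (sub_ne_zero.mpr hac)
  have h3 : a + b + c = 0 := by
    have : (b - c) * (4 * (a + b + c)) = 0 := by linear_combination h1 - h2
    have := (mul_eq_zero.mp this).resolve_left (sub_ne_zero.mpr hbc)
    linarith
  obtain rfl : c = -a - b := by linarith
  obtain rfl : A = 4 * (a ^ 2 + a * b + b ^ 2) := by linarith
  obtain rfl : B = 4 * a ^ 3 - 4 * (a ^ 2 + a * b + b ^ 2) * a := by linarith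
  have : (4 * (a ^ 2 + a * b + b ^ 2)) ^ 3 - 27 * (4 * a ^ 3 - 4 * (a ^ 2 + a * b + b ^ 2) * a) ^ 2
      = 16 * ((a - b) * (b - (-a - b)) * (a - (-a - b))) ^ 2 := by ring
  rw [this]
  have hne : (a - b) * (b - (-a - b)) * (a - (-a - b)) ≠ 0 :=
    mul_ne_zero (mul_ne_zero (sub_ne_zero.mpr hab) (sub_ne_zero.mpr hbc)) (sub_ne_zero.mpr hac)
  positivity

/-- **Rectangular ⇒ `disc > 0`.**  For a real lattice with `g₂³ − 27g₃² ≠ 0` and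
`w + Ω₀/2 ∉ Λ` (`w = iΩ₀'/2`), the line `w + ℝ` misses `Λ`, `℘` is real on it and produces two
roots `m < M` of `f` below `e₁` (`IsReal.exists_Ioo_integral_eq_of_line`), and `M ≠ e₁` since
`e₁` is a simple root; three distinct real roots force `g₂³ − 27g₃² > 0` (Lawden §§6.11–6.12).
[folklore] -/
theorem IsReal.discr_pos_of_halfPeriodI_add_notMem (h : L.IsReal)
    (hdisc : L.g₂.re ^ 3 - 27 * L.g₃.re ^ 2 ≠ 0)
    (hcase : I * (((L.mulLeft I I_ne_zero).minRealPeriod / 2 : ℝ) : ℂ) +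
      ((L.minRealPeriod / 2 : ℝ) : ℂ) ∉ L.lattice) :
    0 < L.g₂.re ^ 3 - 27 * L.g₃.re ^ 2 := by
  set e₁ := L.weierstrassPRe (L.minRealPeriod / 2) with he₁_def
  set A := L.g₂.re with hA
  set B := L.g₃.re with hB
  have he₁ : 4 * e₁ ^ 3 - A * e₁ - B = 0 := h.cubic_weierstrassPRe_half
  have hright : ∀ x, e₁ < x → 0 < 4 * x ^ 3 - A * x - B := fun x hx ↦ h.cubic_pos_of_lt hx
  have h12 : 12 * e₁ ^ 2 - A ≠ 0 := by
    intro h0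
    rw [cubic_discr_eq_of_root he₁, h0] at hdisc
    simp at hdisc
  obtain ⟨h2w, hwn, hcw⟩ := h.two_mul_halfPeriodI_mem
  set w : ℂ := I * (((L.mulLeft I I_ne_zero).minRealPeriod / 2 : ℝ) : ℂ) with hw
  -- the line `w + ℝ` misses `Λ`
  have hline : ∀ t : ℝ, w + t ∉ L.lattice := by
    intro t ht
    have hct : -w + t ∈ L.lattice := by
      have := h _ ht
      rwa [map_add, hcw, Complex.conj_ofReal] at this
    have h2t : ((2 * t : ℝ) : ℂ) ∈ L.lattice := by
      convert add_mem ht hct using 1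
      push_cast; ring
    obtain ⟨k, hk⟩ := h.exists_eq_int_mul h2t
    have hzmul : ∀ j : ℤ, ((j : ℝ) : ℂ) * (L.minRealPeriod : ℂ) ∈ L.lattice := by
      intro j
      have := zsmul_mem h.minRealPeriod_mem_lattice j
      rw [zsmul_eq_mul] at this
      exact_mod_cast this
    rcases Int.even_or_odd k with ⟨j, rfl⟩ | ⟨j, rfl⟩
    · have ht' : t = j * L.minRealPeriod := by push_cast at hk; linarith
      have htmem : (t : ℂ) ∈ L.lattice := by
        rw [ht']; push_cast
        exact_mod_cast hzmul j
      exact hwn (by simpa using sub_mem ht htmem)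
    · have ht' : t = j * L.minRealPeriod + L.minRealPeriod / 2 := by push_cast at hk; linarith
      refine hcase ?_
      convert sub_mem ht (hzmul j) using 1
      rw [ht']; push_cast; ring
  obtain ⟨m, M, hmM, hfm, hfM, hfpos, -⟩ := h.exists_Ioo_integral_eq_of_line h2w hcw hline
  have hMe : M ≤ e₁ := by
    by_contra hcon
    push Not at hcon
    have := hright M hcon
    rw [hfM] at this
    exact lt_irrefl 0 this
  have hMne : M ≠ e₁ := by
    intro hMe₁
    apply h12
    refine twelve_mul_sq_sub_eq_zero he₁ (m := m) (by rw [← hMe₁]; exact hmM)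
      (fun x hx ↦ hfpos x (by rw [hMe₁]; exact hx)) hright
  have hMlt : M < e₁ := lt_of_le_of_ne hMe hMne
  have hme : m ≠ e₁ := (hmM.trans hMlt).ne
  exact cubic_discr_pos_of_roots hmM.ne hme hMne hfm hfM he₁

/-! ### The index `[R : ℝ + Λ]` is the number of real components -/

section Index

variable {R B : AddSubgroup ℂ} (hR : ∀ z, z ∈ R ↔ conj z - z ∈ L.lattice)
  (hB : ∀ z, z ∈ B ↔ (z.re : ℂ) = z)

include hR hB in
/-- **Number of real components.**  For a real lattice `Λ` with `g₂³ − 27g₃² ≠ 0` (automatic), the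
real locus `R = {z | conj z − z ∈ Λ}` contains `ℝ + Λ` with index `2` if `g₂³ − 27g₃² > 0`
(rectangular lattice: `R = (ℝ + Λ) ∪ (iΩ₀'/2 + ℝ + Λ)`) and index `1` if `g₂³ − 27g₃² < 0`
(rhombic lattice). Through `z ↦ (℘(z), ℘'(z))` this is the statement that `E(ℝ)` has two
components if `Δ > 0` and one if `Δ < 0` (Silverman, *ATAEC*, V.2; Lawden §§6.15–6.16).
[folklore] -/
theorem IsReal.relIndex_realLine_sup_lattice (h : L.IsReal)
    (hdisc : L.g₂.re ^ 3 - 27 * L.g₃.re ^ 2 ≠ 0) :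
    (B ⊔ L.lattice.toAddSubgroup).relIndex R =
      if 0 < L.g₂.re ^ 3 - 27 * L.g₃.re ^ 2 then 2 else 1 := by
  set H := B ⊔ L.lattice.toAddSubgroup with hH
  obtain ⟨h2w, hwn, hcw⟩ := h.two_mul_halfPeriodI_mem
  set w : ℂ := I * (((L.mulLeft I I_ne_zero).minRealPeriod / 2 : ℝ) : ℂ) with hw
  have hHR : H ≤ R := sup_le (realLine_le_realLocus hR hB) (lattice_le_realLocus hR h)
  have hwR : w ∈ R := (hR w).2 (by
    rw [hcw, show -w - w = -(2 * w) by ring]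
    exact neg_mem h2w)
  have h2wH : 2 * w ∈ H := AddSubgroup.mem_sup_right h2w
  by_cases hwH : w ∈ H
  · -- rhombic: index one, `disc < 0`
    have hmem := (h.halfPeriodI_mem_sup_iff hB).1 hwH
    have hnot : ¬ 0 < L.g₂.re ^ 3 - 27 * L.g₃.re ^ 2 := fun hpos ↦
      h.half_add_I_mul_half_notMem_of_discr_pos hpos hmem
    rw [if_neg hnot, AddSubgroup.relIndex_eq_one]
    intro z hz
    rcases h.mem_sup_or_sub_mem_sup hR hB hz with hz' | hz'
    · exact hz'
    · convert add_mem hz' hwH using 1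
      rw [hw]; ring
  · -- rectangular: index two, `disc > 0`
    have hnotmem : w + ((L.minRealPeriod / 2 : ℝ) : ℂ) ∉ L.lattice := fun hmem ↦
      hwH ((h.halfPeriodI_mem_sup_iff hB).2 hmem)
    have hpos := h.discr_pos_of_halfPeriodI_add_notMem hdisc hnotmem
    rw [if_pos hpos, AddSubgroup.relIndex, AddSubgroup.index_eq_two_iff]
    refine ⟨⟨w, hwR⟩, fun b ↦ ?_⟩
    simp only [AddSubgroup.mem_addSubgroupOf, AddSubgroup.coe_add]
    rcases h.mem_sup_or_sub_mem_sup hR hB b.2 with hb | hb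
    · refine Or.inr ⟨hb, fun hbw ↦ hwH ?_⟩
      simpa using sub_mem hbw hb
    · have hbnot : (b : ℂ) ∉ H := fun hb' ↦ hwH (by
        convert sub_mem hb' hb using 1
        rw [hw]; ring)
      refine Or.inl ⟨?_, hbnot⟩
      have : (b : ℂ) + w = ((b : ℂ) - w) + 2 * w := by ring
      rw [this]
      exact add_mem hb h2wH

end Index

end PeriodPair

namespace PeriodPair

open Complex Set

variable {L L' : PeriodPair}

/-! ### The kernel of `z ↦ αz` on the real circle `ℝ/ℤΩ₀ → ℝ/ℤΩ₀'` -/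

/-- **Kernel count on the identity component.**  Let `Λ, Λ'` be real lattices with least positive
real periods `Ω₀, Ω₀'`, and `α ≠ 0` real with `αΛ ⊆ Λ'`.  The subgroup
`S = {t ∈ ℝ | αt ∈ Λ'} = ℤ · Ω₀'/α` contains `Λ ∩ ℝ = ℤΩ₀` with index `k₀ = |α|Ω₀/Ω₀'`; i.e. the
kernel of `t ↦ αt : ℝ/ℤΩ₀ → ℝ/ℤΩ₀'` has `k₀` elements, `k₀ · Ω₀' = |α| · Ω₀`. [folklore] -/
theorem IsReal.relIndex_lattice_mul_minRealPeriod_eq (h : L.IsReal) (h' : L'.IsReal) {α : ℝ}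
    (hα0 : α ≠ 0) (hα : ∀ l ∈ L.lattice, (α : ℂ) * l ∈ L'.lattice) {S : AddSubgroup ℂ}
    (hS : ∀ z, z ∈ S ↔ (z.re : ℂ) = z ∧ (α : ℂ) * z ∈ L'.lattice) :
    (L.lattice.toAddSubgroup.relIndex S : ℝ) * L'.minRealPeriod = |α| * L.minRealPeriod := by
  have hΩ := h.minRealPeriod_pos
  have hΩ' := h'.minRealPeriod_pos
  set c : ℝ := L'.minRealPeriod / α with hc
  have hc0 : c ≠ 0 := div_ne_zero hΩ'.ne' hα0
  have hαc : α * c = L'.minRealPeriod := by rw [hc]; field_simp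
  -- `αΩ₀ = m Ω₀'`, so `Ω₀ = m c`
  have hαΩ : ((α * L.minRealPeriod : ℝ) : ℂ) ∈ L'.lattice := by
    push_cast; exact hα _ h.minRealPeriod_mem_lattice
  obtain ⟨m, hm⟩ := h'.exists_eq_int_mul hαΩ
  have hΩm : L.minRealPeriod = m * c := by
    rw [hc]; field_simp; linarith
  -- the map `k ↦ k c` from `ℤ` onto `S`
  set f : ℤ →+ ℂ := (zmultiplesHom ℂ) (c : ℂ) with hf
  have hfk : ∀ k : ℤ, f k = (k : ℂ) * c := fun k ↦ by simp [hf]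
  have hrange : f.range = S := by
    ext z
    rw [AddMonoidHom.mem_range, hS]
    constructor
    · rintro ⟨k, rfl⟩
      rw [hfk]
      refine ⟨by simp, ?_⟩
      have : (α : ℂ) * ((k : ℂ) * c) = ((k : ℝ) : ℂ) * (L'.minRealPeriod : ℂ) := by
        rw [← hαc]; push_cast; ring
      rw [this]
      have := zsmul_mem h'.minRealPeriod_mem_lattice k
      rw [zsmul_eq_mul] at this
      exact_mod_cast this
    · rintro ⟨hz, hαz⟩
      have hαz' : (((α * z.re : ℝ)) : ℂ) ∈ L'.lattice := by
        push_cast; rw [hz]; exact hαz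
      obtain ⟨j, hj⟩ := h'.exists_eq_int_mul hαz'
      refine ⟨j, ?_⟩
      rw [hfk, ← hz]
      have : z.re = j * c := by
        rw [hc]; field_simp; linarith
      rw [this]; push_cast; ring
  -- `ℤΩ₀ = ℤ m c` pulls back to `mℤ`
  have hcomap : L.lattice.toAddSubgroup.comap f = AddSubgroup.zmultiples m := by
    ext k
    rw [AddSubgroup.mem_comap, Submodule.mem_toAddSubgroup, Int.mem_zmultiples_iff, hfk]
    constructor
    · intro hk
      have hk' : (((k : ℝ) * c : ℝ) : ℂ) ∈ L.lattice := by push_cast; exact hk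
      obtain ⟨j, hj⟩ := h.exists_eq_int_mul hk'
      refine ⟨j, ?_⟩
      rw [hΩm] at hj
      have : ((k : ℝ) - j * m) * c = 0 := by linarith
      have := (mul_eq_zero.mp this).resolve_right hc0
      exact_mod_cast (by linarith : (k : ℝ) = m * j)
    · rintro ⟨j, rfl⟩
      have : (((m * j : ℤ)) : ℂ) * c = ((j : ℝ) : ℂ) * (L.minRealPeriod : ℂ) := by
        rw [hΩm]; push_cast; ring
      rw [this]
      have := zsmul_mem h.minRealPeriod_mem_lattice j
      rw [zsmul_eq_mul] at this
      exact_mod_cast this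
  have hidx : L.lattice.toAddSubgroup.relIndex S = m.natAbs := by
    rw [← hrange, AddMonoidHom.range_eq_map, ← AddSubgroup.relIndex_comap,
      AddSubgroup.relIndex_top_right, hcomap, Int.index_zmultiples]
  rw [hidx, Nat.cast_natAbs, Int.cast_abs, ← abs_of_pos hΩ', ← abs_mul, ← hm, abs_mul,
    abs_of_pos hΩ]

end PeriodPair
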